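import Literature.Analysis.FluidPDE.CKNEpsilonRegularity
import Literature.Analysis.FluidPDE.LocalTypeI
import HarnessLib

/-!
# Caffarelli–Kohn–Nirenberg 1982: the setting of §2 and Proposition 2 as printed

Analysis/FluidPDE file in the decomposition of the named fact
`Literature.Analysis.FluidPDE.ckn_epsilon_regularity` (`PartialRegularity.lean`, ns.S12:
Caffarelli–Kohn–Nirenberg 1982, Proposition 2 — an *absolute* `ε > 0` such that, for a suitable
weak solution (`ν = 1`) on an open `Q ⊆ ℝ × ℝ³` with a force `f ∈ L^q(Q)`, `q > 5/2`, `div f = 0`,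
`limsup_{r → 0} r⁻¹ ∫∫_{Q*_r(z)} |∇u|² ≤ ε` makes `z` a regular point).

The accepted companion file `CKNEpsilonRegularity.lean` vendors the two *printed* ε-regularity
theorems with a force that the literature store holds (Lemarié-Rieusset 2016, Thm. 13.8 and
Thm. 14.4) and proves from the first one the exponent-dependent form
`ckn_epsilon_regularity_of_exponent` (`∀ q > 5/2, ∃ ε(q)`) and the unforced form; as recorded
there, the printed constants of those theorems depend on the integrability (Morrey) exponent of
the force, so the absolute constant of ns.S12 does not follow from them. The only printed source
for one absolute constant *with* a force `f ∈ L^q`, `q > 5/2`, is Caffarelli–Kohn–Nirenberg's own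
paper, whose Proposition 1 ("There are absolute constants `ε₁` and `C₁ > 0` …") and Proposition 2
("There is an absolute constant `ε₃ > 0` …") carry the exponent `q` only inside the standing
hypothesis "`f ∈ L^q` for some `q > 5/2`" of their §2.

This file therefore vendors Caffarelli–Kohn–Nirenberg's **own setting** and **Proposition 2 as
printed**, and proves that ns.S12 follows from it:

* `CKN1982.IsSuitableOn D q f u p G` — the hypotheses (2.1)–(2.5) of CKN 1982, §2, on an open set
  `D ⊆ ℝ × ℝ³` (there a space–time cylinder; every open set restricts to one): `f ∈ L^q(D)` with
  `q > 5/2` and `∇·f = 0`; `p ∈ L^{5/4}(D)`; `u ∈ L^∞_t L²_x(D)` (`∫_{D_t} |u|² ≤ E₀` for a.e. `t`)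
  and `∇u ∈ L²(D)` (`∫∫_D |∇u|² ≤ E₁`), the distributional gradient being the explicit argument
  `G` (`Fluid.HasWeakSpatialGradientOn`); `(u, p)` solves `uₜ + u·∇u - Δu + ∇p = f`, `∇·u = 0`
  (CKN (1.1), viscosity `1`) in `𝒟'(D)`; and the generalized energy inequality
  `2 ∫∫ |∇u|² φ ≤ ∫∫ (|u|² (φₜ + Δφ) + (|u|² + 2p) u·∇φ + 2 (u·f) φ)` for all `0 ≤ φ ∈ C₀^∞(D)`.
  These are *global* classes on `D` and the pressure class is `L^{5/4}`, exactly as printed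
  (the accepted `Fluid.IsSuitableWeakSolutionOn` is the local, `L^{3/2}` version of Lin 1998).
* `CKN1982.deltaStar r z G = r⁻¹ ∫∫_{Q*_r(z)} |∇u|²` — the quantity of Proposition 2 (centred
  cylinders `Q*_r(t, x) = (t - r², t + r²) × B_r(x)`, CKN (2.6)/§6).
* `CKN1982.proposition2` — **Proposition 2 as printed**: an absolute `ε₃ > 0` such that for
  `(u, p)` suitable (in the above sense) on an open `D ∋ z`,
  `limsup_{r → 0} δ*(r) ≤ ε₃` implies that `z` is a regular point (`u ∈ L^∞` on a
  neighbourhood of `z`, i.e. `Fluid.IsRegularPoint`: essentially bounded on some `Q*_ρ(z)`).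
* `ckn_epsilon_regularity_of_proposition2 : CKN1982.proposition2 → ckn_epsilon_regularity` —
  **proved**: for `z ∈ Q` restrict the accepted (local, `L^{3/2}`) suitable weak solution to a
  centred cylinder `Ω = Q*_{r₁}(z)` whose closure `[t - r₁², t + r₁²] × B̄(x, r₁)` is a compact
  subset of `Q`; on `Ω` the local classes become CKN's global ones and `p ∈ L^{3/2}(Ω) ⊆ L^{5/4}(Ω)`
  (Hölder against `1`, `|Ω| < ∞`), the force class `IsCKNForceOn` restricts, and the `limsup`
  hypothesis of ns.S12 is literally that of Proposition 2 for the gradient `G` carried by the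
  structure. Hence ns.S12 is a faithful (slightly specialised: `p ∈ L^{3/2}_{loc}`) rendering of
  the printed Proposition 2, with the same quantifier shape (`∃ ε ∀ q`).

What is deliberately NOT here: Proposition 1 / its Corollary (the one-scale criterion) and the
decay lemmas from which CKN prove Proposition 2 (to be vendored verbatim from the paper, which
the literature store does not yet hold — the PDF filed under its DOI is a different document), and
Theorem B (`𝒫¹(S) = 0`, ns.S11). The second half of this file is text-independent glue for that
proof: `limsup` along `r → 0⁺` to an interval bound, the shifted-cylinder inclusions
`Q_r(t + h, x) ⊆ Q*_r(t, x)` (`0 ≤ h ≤ r²`) and `Q*_ρ(t, x) ⊆ Q_s(t + h, x)`, the geometric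
iteration `φ(γᵏρ₀) ≤ 2b + 2⁻ᵏφ(ρ₀)` in `ℝ≥0∞`, regular points from an a.e. bound on a superset
of a centred cylinder, and the slice bound `A_ess(r) ≤ r⁻¹E₀` for the accepted `cknAEss`.

## Mathlib / tree search

No Navier–Stokes notion in Mathlib (this pin). Everything is phrased with the accepted prelude
(`Fluid.IsDistributionalNSSolutionOn`, `Fluid.HasWeakSpatialGradientOn`, `Fluid.IsSpaceTimeTestOn`,
`Fluid.parabolicCylinderCentered`, `Fluid.IsRegularPoint`, `Fluid.frobeniusNormSq`, `IsCKNForceOn`)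
and the glue of `CKNEpsilonRegularity.lean` (`exists_closedCylinder_subset`,
`setLIntegral_rpow_le_rpow_mul_measure`, …). Used from Mathlib: `MemLp.mono_measure`,
`LocallyIntegrableOn.integrableOn_compact_subset`, `ENNReal.rpow_lt_top_of_nonneg`.

## Design notes

* `q` is an explicit parameter of `CKN1982.IsSuitableOn` because Proposition 1's hypothesis
  (3.2) `∫∫ |f|^q ≤ ε₁` names it; Proposition 2 quantifies `∀ q` after `∃ ε₃`, as printed
  ("absolute constant"; `q` lives in the standing hypotheses of §2).
* "sup over `t`" classes are rendered by `∀ᵐ t` (CKN's (2.3) holds for almost every `t`).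
* Physical space is `ℝ³ = EuclideanSpace ℝ (Fin 3)`, time first, as in `PartialRegularity.lean`.

## References

* L. Caffarelli, R. Kohn, L. Nirenberg, *Partial regularity of suitable weak solutions of the
  Navier–Stokes equations*, Comm. Pure Appl. Math. 35 (1982), 771–831: §2, (1.1), (2.1)–(2.6),
  Propositions 1–2. [CaffarelliKohnNirenberg1982]
* P. G. Lemarié-Rieusset, *The Navier–Stokes Problem in the 21st Century* (2016), §13.8,
  p. 459 (the list of CKN's original hypotheses 1–7). [LemarieRieusset2016]
* F. Lin, *A new proof of the Caffarelli–Kohn–Nirenberg theorem*, CPAM 51 (1998), Def. 1,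
  Thm. 1.1. [Lin1998]
-/

noncomputable section

open MeasureTheory Set Function Filter TopologicalSpace Metric
open scoped NNReal ENNReal InnerProductSpace RealInnerProductSpace Laplacian Topology

namespace Literature.Analysis.FluidPDE

/-- Local notation for physical space `ℝ³ = EuclideanSpace ℝ (Fin 3)`. -/
local notation "ℝ³" => EuclideanSpace ℝ (Fin 3)

namespace CKN1982

/-- **Suitable weak solutions in the sense of Caffarelli–Kohn–Nirenberg 1982, §2, (2.1)–(2.5)**,
on an open set `D ⊆ ℝ × ℝ³` of space–time, for the system (1.1)
`uₜ + u·∇u - Δu + ∇p = f`, `∇·u = 0` (viscosity `1`), with the weak spatial gradient `G = ∇u`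
made explicit and the force exponent `q` as a parameter. The hypotheses are, as printed in §2 and
as listed in Lemarié-Rieusset 2016, p. 459 (items 1–6): `f ∈ L^q(D)` for some `q > 5/2` with
`∇·f = 0`; `p ∈ L^{5/4}(D)`; `u ∈ L^∞_t L²_x ∩ L²_t H¹_x` on `D`, i.e. `∫_{D_t} |u|² dx ≤ E₀` for
almost every `t` and `∫∫_D |∇u|² ≤ E₁`; `(u, p)` is a weak solution of (1.1) in `𝒟'(D)`; and the
generalized energy inequality holds for every `0 ≤ φ ∈ C₀^∞(D)`:
`2 ∫∫ |∇u|² φ ≤ ∫∫ (|u|² (φₜ + Δφ) + (|u|² + 2p) u·∇φ + 2 (u·f) φ)`.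
(CKN state these on a space–time cylinder `D`; the class restricts to open subsets, so an
arbitrary open `D` changes nothing in Propositions 1–2.) All classes are *global* on `D` and the
pressure class is `L^{5/4}` — the accepted `Fluid.IsSuitableWeakSolutionOn` is the local `L^{3/2}`
version of Lin 1998, Def. 1. [cite: CaffarelliKohnNirenberg1982, §2 (2.1)–(2.5) and (1.1)] -/
structure IsSuitableOn (D : Opens (ℝ × ℝ³)) (q : ℝ) (f u : ℝ → ℝ³ → ℝ³) (p : ℝ → ℝ³ → ℝ)
    (G : ℝ → ℝ³ → ℝ³ →L[ℝ] ℝ³) : Prop where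
  /-- The force exponent satisfies `q > 5/2`. -/
  exponent : 5 / 2 < q
  /-- `f ∈ L^q(D)`. -/
  force_memLp : MemLp (uncurry f) (ENNReal.ofReal q) (volume.restrict (D : Set (ℝ × ℝ³)))
  /-- `∇ · f = 0` in `𝒟'(D)`. -/
  force_div : ∀ φ : ℝ → ℝ³ → ℝ, IsSpaceTimeTestOn D φ → ∫ t, ∫ x, ⟪f t x, gradient (φ t) x⟫ = 0
  /-- `p ∈ L^{5/4}(D)`. -/
  pressure : ∫⁻ z in (D : Set (ℝ × ℝ³)), ‖p z.1 z.2‖ₑ ^ (5 / 4 : ℝ) < ∞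
  /-- `∫_{D_t} |u|² dx ≤ E₀` for almost every `t` (`u ∈ L^∞_t L²_x(D)`). -/
  energy : ∃ E₀ : ℝ≥0, ∀ᵐ t : ℝ,
    ∫⁻ x, (D : Set (ℝ × ℝ³)).indicator (fun z : ℝ × ℝ³ => ‖u z.1 z.2‖ₑ ^ 2) (t, x) ≤ E₀
  /-- `∇u` exists weakly on `D` (represented by `G`) ... -/
  weakGrad : HasWeakSpatialGradientOn D u G
  /-- ... and `∫∫_D |∇u|² ≤ E₁ < ∞` (`u ∈ L²_t H¹_x(D)`). -/
  dissipation : ∫⁻ z in (D : Set (ℝ × ℝ³)), ENNReal.ofReal (frobeniusNormSq (G z.1 z.2)) < ∞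
  /-- `(u, p)` solves (1.1) (viscosity `1`) on `D` in the sense of distributions, `∇ · u = 0` included. -/
  distributional : IsDistributionalNSSolutionOn D 1 f u p
  /-- The generalized energy inequality for every nonnegative `φ ∈ C₀^∞(D)`. -/
  localEnergy : ∀ φ : ℝ → ℝ³ → ℝ, IsSpaceTimeTestOn D φ → (∀ t x, 0 ≤ φ t x) →
    2 * ∫ t, ∫ x, frobeniusNormSq (G t x) * φ t x ≤
      ∫ t, ∫ x, (‖u t x‖ ^ 2 * (timeDeriv φ t x + Δ (φ t) x) +
        (‖u t x‖ ^ 2 + 2 * p t x) * ⟪u t x, gradient (φ t) x⟫ +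
        2 * ⟪f t x, u t x⟫ * φ t x)

/-- The quantity of Proposition 2: the scaled dissipation over the *centred* cylinder
`Q*_r(t, x) = (t - r², t + r²) × B_r(x)` (CKN 1982, (2.6)), `δ*(r) = r⁻¹ ∫∫_{Q*_r(z)} |∇u|²`, in
`ℝ≥0∞`, with `G` standing for `∇u`. Intended for `r > 0` (for `r ≤ 0` the cylinder is empty and
`(ENNReal.ofReal r)⁻¹ = ∞`, junk `∞ * 0 = 0`). [cite: CaffarelliKohnNirenberg1982, Proposition 2] -/
def deltaStar (r : ℝ) (z : ℝ × ℝ³) (G : ℝ → ℝ³ → ℝ³ →L[ℝ] ℝ³) : ℝ≥0∞ :=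
  (ENNReal.ofReal r)⁻¹ *
    ∫⁻ w in parabolicCylinderCentered r z, ENNReal.ofReal (frobeniusNormSq (G w.1 w.2))

/-- **Caffarelli–Kohn–Nirenberg 1982, Proposition 2**: there is an *absolute* constant `ε₃ > 0`
such that, if `(u, p)` is a suitable weak solution of the Navier–Stokes system (1.1) near the
space–time point `z = (t, x)` — i.e. `CKN1982.IsSuitableOn D q f u p G` on some open `D ∋ z`, for
some force exponent `q > 5/2`, which is quantified *after* `ε₃` — and
`limsup_{r → 0} r⁻¹ ∫∫_{Q*_r(z)} |∇u|² ≤ ε₃` (centred cylinders, CKN (2.6); Lemarié-Rieusset 2016,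
p. 459 reports the criterion in exactly this form), then `z` is a regular point: `u` is `L^∞` on a
neighbourhood of `z`, i.e. the accepted `Fluid.IsRegularPoint` (essentially bounded on some centred
cylinder `Q*_ρ(z)`; these cylinders form a neighbourhood basis). Whether the printed smallness is
`≤ ε₃` or `< ε₃` is immaterial behind `∃ ε₃`. ns.S12 `ckn_epsilon_regularity` follows
(`ckn_epsilon_regularity_of_proposition2`). [cite: CaffarelliKohnNirenberg1982, Proposition 2] -/
def proposition2 : Prop :=
  ∃ ε₃ : ℝ, 0 < ε₃ ∧ ∀ (D : Opens (ℝ × ℝ³)) (q : ℝ) (f u : ℝ → ℝ³ → ℝ³) (p : ℝ → ℝ³ → ℝ)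
      (G : ℝ → ℝ³ → ℝ³ →L[ℝ] ℝ³), IsSuitableOn D q f u p G →
      ∀ z ∈ D, limsup (fun r : ℝ => deltaStar r z G) (𝓝[>] (0 : ℝ)) ≤ ENNReal.ofReal ε₃ →
        IsRegularPoint u z

end CKN1982

/-! ### From the printed Proposition 2 to ns.S12 (`ckn_epsilon_regularity`) -/

/-- `L^{3/2} ⊆ L^{5/4}` on sets of finite measure (Hölder against `1`). [folklore] -/
theorem setLIntegral_rpow_five_fourths_lt_top {s : Set (ℝ × ℝ³)} (hs : volume s ≠ ∞)
    {P : ℝ × ℝ³ → ℝ} (hP : AEStronglyMeasurable P (volume.restrict s))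
    (h : ∫⁻ z in s, ‖P z‖ₑ ^ (3 / 2 : ℝ) < ∞) :
    ∫⁻ z in s, ‖P z‖ₑ ^ (5 / 4 : ℝ) < ∞ := by
  have H := setLIntegral_rpow_le_rpow_mul_measure volume s hP.enorm (a := 5 / 4) (b := 3 / 2)
    (by norm_num) (by norm_num)
  refine H.trans_lt (ENNReal.mul_lt_top ?_ ?_)
  · exact ENNReal.rpow_lt_top_of_nonneg (by norm_num) h.ne
  · exact ENNReal.rpow_lt_top_of_nonneg (by norm_num) hs

/-- **ns.S12 from Caffarelli–Kohn–Nirenberg's printed Proposition 2.** For `z ∈ Q` restrict the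
accepted (local, `L^{3/2}`) suitable weak solution to the centred cylinder `Ω = Q*_{r₁}(z)` whose
closed box `[t - r₁², t + r₁²] × B̄(x, r₁)` is a compact subset of `Q`: on `Ω` the local classes
of `Fluid.IsSuitableWeakSolutionOn` are CKN's global ones, `p ∈ L^{3/2}(Ω) ⊆ L^{5/4}(Ω)`
(`|Ω| < ∞`), the CKN force restricts, and the `limsup` hypothesis of ns.S12 for the gradient `G`
carried by the structure is that of Proposition 2 (Caffarelli–Kohn–Nirenberg 1982, §2 and
Proposition 2; the localisation is the one of `ckn_epsilon_regularity_of_exponent`). [cite: CaffarelliKohnNirenberg1982, Proposition 2] -/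
theorem ckn_epsilon_regularity_of_proposition2 (h : CKN1982.proposition2) :
    ckn_epsilon_regularity := by
  obtain ⟨ε, hε, H⟩ := h
  refine ⟨ε, hε, fun Q f u p hsws hf z hz hlim => ?_⟩
  -- a closed parabolic box around `z` inside `Q`, and the open centred cylinder `Ω` inside it
  obtain ⟨r₁, hr₁, -, hKQ⟩ := exists_closedCylinder_subset Q.isOpen hz
  set K : Set (ℝ × ℝ³) := Icc (z.1 - r₁ ^ 2) (z.1 + r₁ ^ 2) ×ˢ closedBall z.2 r₁ with hK
  have hKc : IsCompact K := isCompact_Icc.prod (isCompact_closedBall _ _)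
  set Ω : Opens (ℝ × ℝ³) := parabolicCylinderCenteredOpens r₁ z with hΩdef
  have hΩK : (Ω : Set (ℝ × ℝ³)) ⊆ K := parabolicCylinderCentered_subset_closedCylinder r₁ z
  have hΩQ' : (Ω : Set (ℝ × ℝ³)) ⊆ (Q : Set (ℝ × ℝ³)) := hΩK.trans hKQ
  have hΩQ : Ω ≤ Q := hΩQ'
  have hzΩ : z ∈ Ω := self_mem_parabolicCylinderCentered hr₁ z
  have hΩfin : volume (Ω : Set (ℝ × ℝ³)) < ∞ := (measure_mono hΩK).trans_lt hKc.measure_lt_top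
  -- the data of the suitable weak solution
  obtain ⟨G, hG, hGL2, hLE⟩ := hsws.localEnergy
  obtain ⟨Cu, hCu⟩ := hsws.energyClass K hKQ hKc
  -- the CKN class on `Ω`
  obtain ⟨⟨q, hq, hfq⟩, hdiv⟩ := hf
  have hS : CKN1982.IsSuitableOn Ω q f u p G := by
    refine ⟨hq, hfq.mono_measure (Measure.restrict_mono hΩQ' le_rfl),
      fun φ hφ => hdiv φ (hφ.mono hΩQ), ?_, ?_, hG.mono hΩQ, ?_, hsws.distributional.of_le hΩQ, ?_⟩
    · -- `p ∈ L^{5/4}(Ω)` from `p ∈ L^{3/2}(K)`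
      have hpm : AEStronglyMeasurable (uncurry p) (volume.restrict (Ω : Set (ℝ × ℝ³))) :=
        ((hsws.distributional.2.2.1.integrableOn_compact_subset hKQ hKc).mono_set
          hΩK).aestronglyMeasurable
      have h32 : ∫⁻ w in (Ω : Set (ℝ × ℝ³)), ‖p w.1 w.2‖ₑ ^ (3 / 2 : ℝ) < ∞ :=
        (lintegral_mono_set hΩK).trans_lt (hsws.pressure K hKQ hKc)
      exact setLIntegral_rpow_five_fourths_lt_top hΩfin.ne hpm h32
    · -- energy
      refine ⟨Cu, ?_⟩
      filter_upwards [hCu] with t ht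
      refine (lintegral_mono fun x => ?_).trans ht
      exact indicator_le_indicator_of_subset hΩK (fun _ => zero_le) _
    · -- dissipation
      exact (lintegral_mono_set hΩK).trans_lt (hGL2 K hKQ hKc)
    · -- the generalized energy inequality (`ν = 1`)
      intro φ hφ hφ0
      have := hLE φ (hφ.mono hΩQ) hφ0
      simpa only [one_mul, mul_one] using this
  -- apply Proposition 2 on `Ω`
  exact H Ω q f u p G hS z hzΩ (hlim G hG)

/-! ### Glue for the proof of Proposition 2: `limsup`, shifted cylinders, geometric iteration -/

section Glue

/-- A `limsup` bound along `r → 0⁺` in `ℝ≥0∞` below a strictly larger level `b` gives an interval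
`(0, r₀)` on which the function stays below `b`. [folklore] -/
theorem exists_forall_lt_of_limsup_le {φ : ℝ → ℝ≥0∞} {a b : ℝ≥0∞}
    (h : limsup φ (𝓝[>] (0 : ℝ)) ≤ a) (hab : a < b) :
    ∃ r₀ : ℝ, 0 < r₀ ∧ ∀ r, 0 < r → r < r₀ → φ r < b := by
  have hev : ∀ᶠ r in 𝓝[>] (0 : ℝ), φ r < b :=
    Filter.eventually_lt_of_limsup_lt (lt_of_le_of_lt h hab)
  obtain ⟨u, hu, hsub⟩ := mem_nhdsGT_iff_exists_Ioo_subset.1 hev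
  exact ⟨u, hu, fun r hr hru => hsub ⟨hr, hru⟩⟩

variable {X : Type*} [PseudoMetricSpace X]

/-- **Shifted backward cylinders inside a centred one**: `Q_r(t + h, x) ⊆ Q*_r(t, x)` for
`0 ≤ h ≤ r²` (Caffarelli–Kohn–Nirenberg 1982, §6: Proposition 1 is applied on a cylinder whose
top lies slightly in the future of the point). [folklore] -/
theorem parabolicCylinder_shift_subset_centered {r h : ℝ} (h0 : 0 ≤ h) (hr : h ≤ r ^ 2)
    (z : ℝ × X) :
    parabolicCylinder r (z.1 + h, z.2) ⊆ parabolicCylinderCentered r z := by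
  intro w hw
  rw [mem_parabolicCylinder] at hw
  rw [mem_parabolicCylinderCentered]
  obtain ⟨⟨h1, h2⟩, h3⟩ := hw
  exact ⟨⟨by dsimp only at h1; linarith, by dsimp only at h2; linarith⟩, h3⟩

/-- **A centred cylinder inside a shifted backward one**: `Q*_ρ(t, x) ⊆ Q_s(t + h, x)` when
`ρ ≤ s`, `ρ² ≤ h` and `h + ρ² ≤ s²` (e.g. `s = r/2`, `h = r²/8`, `ρ = r/(2√2)`:
`Q_{r/2}(t + r²/8, x) ⊇ Q*_{r/(2√2)}(t, x)`). [folklore] -/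
theorem parabolicCylinderCentered_subset_shift {ρ s h : ℝ} (h1 : ρ ≤ s) (h2 : ρ ^ 2 ≤ h)
    (h3 : h + ρ ^ 2 ≤ s ^ 2) (z : ℝ × X) :
    parabolicCylinderCentered ρ z ⊆ parabolicCylinder s (z.1 + h, z.2) := by
  intro w hw
  rw [mem_parabolicCylinderCentered] at hw
  rw [mem_parabolicCylinder]
  obtain ⟨⟨h4, h5⟩, h6⟩ := hw
  exact ⟨⟨by dsimp only; linarith, by dsimp only; linarith⟩, h6.trans_le h1⟩

/-- Backward parabolic cylinders are monotone in the radius for `0 ≤ r ≤ r'`. [folklore] -/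
theorem parabolicCylinder_mono {r r' : ℝ} (hr : 0 ≤ r) (h : r ≤ r') (z : ℝ × X) :
    parabolicCylinder r z ⊆ parabolicCylinder r' z := by
  have h2 : r ^ 2 ≤ r' ^ 2 := pow_le_pow_left₀ hr h 2
  exact prod_mono (Ioo_subset_Ioo (by linarith) le_rfl) (ball_subset_ball h)

omit [PseudoMetricSpace X] in
/-- **Geometric iteration** in `ℝ≥0∞`: if `φ(γρ) ≤ φ(ρ)/2 + b` for all `ρ ∈ (0, ρ₀]`
(`0 < γ ≤ 1`), then `φ(γᵏ ρ₀) ≤ 2b + 2⁻ᵏ φ(ρ₀)` (Robinson–Rodrigo–Sadowski 2016, Exercise 16.2;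
the iteration step in every proof of CKN's Proposition 2). [folklore] -/
theorem iterate_half_le {φ : ℝ → ℝ≥0∞} {b : ℝ≥0∞} {γ ρ₀ : ℝ} (hγ : 0 < γ) (hγ1 : γ ≤ 1)
    (hρ₀ : 0 < ρ₀) (h : ∀ ρ, 0 < ρ → ρ ≤ ρ₀ → φ (γ * ρ) ≤ φ ρ / 2 + b) (k : ℕ) :
    φ (γ ^ k * ρ₀) ≤ 2 * b + (2⁻¹ : ℝ≥0∞) ^ k * φ ρ₀ := by
  induction k with
  | zero => simp
  | succ k ih =>
    have hk0 : 0 < γ ^ k * ρ₀ := by positivity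
    have hk1 : γ ^ k * ρ₀ ≤ ρ₀ := by
      have : γ ^ k ≤ 1 := pow_le_one₀ hγ.le hγ1
      nlinarith
    have hstep := h (γ ^ k * ρ₀) hk0 hk1
    rw [← mul_assoc, ← pow_succ'] at hstep
    calc φ (γ ^ (k + 1) * ρ₀) ≤ φ (γ ^ k * ρ₀) / 2 + b := hstep
      _ ≤ (2 * b + (2⁻¹ : ℝ≥0∞) ^ k * φ ρ₀) / 2 + b := by
          gcongr
      _ = 2 * b + (2⁻¹ : ℝ≥0∞) ^ (k + 1) * φ ρ₀ := by
          rw [ENNReal.add_div, pow_succ, div_eq_mul_inv, div_eq_mul_inv, mul_comm (2 : ℝ≥0∞) b,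
            mul_assoc b, ENNReal.mul_inv_cancel two_ne_zero ENNReal.ofNat_ne_top, mul_one]
          ring

omit [PseudoMetricSpace X] in
/-- Powers of `1/2` times a finite constant are eventually below any positive level. [folklore] -/
theorem exists_inv_two_pow_mul_le {c b : ℝ≥0∞} (hc : c ≠ ∞) (hb : 0 < b) :
    ∃ k : ℕ, (2⁻¹ : ℝ≥0∞) ^ k * c ≤ b := by
  have ht : Tendsto (fun k : ℕ => (2⁻¹ : ℝ≥0∞) ^ k * c) atTop (𝓝 (0 * c)) :=
    ENNReal.Tendsto.mul_const (ENNReal.tendsto_pow_atTop_nhds_zero_of_lt_one (by norm_num))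
      (Or.inr hc)
  rw [zero_mul] at ht
  exact (ht.eventually (ge_mem_nhds hb)).exists

end Glue

section GlueMeasure

variable {X : Type*} [NormedAddCommGroup X] [MeasureSpace X]

/-- A point is regular (`Fluid.IsRegularPoint`) as soon as `u` is a.e. bounded on some set
containing a centred cylinder around it (CKN 1982, §6: "regular points are those where `u` is
`L^∞` in a neighbourhood"). [folklore] -/
theorem isRegularPoint_of_ae_bound_superset {u : ℝ → X → X} {z : ℝ × X} {S : Set (ℝ × X)}
    {ρ C : ℝ} (hρ : 0 < ρ) (hsub : parabolicCylinderCentered ρ z ⊆ S)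
    (hb : ∀ᵐ w ∂(volume.restrict S), ‖u w.1 w.2‖ ≤ C) : IsRegularPoint u z := by
  refine ⟨ρ, hρ, ?_⟩
  rw [eLpNorm_exponent_top]
  refine eLpNormEssSup_lt_top_of_ae_bound (C := C) ?_
  filter_upwards [ae_restrict_of_ae_restrict_of_subset hsub hb] with w hw
  exact hw

end GlueMeasure

/-- Slice bound from the global energy class of CKN's (2.3): if `I ×ˢ B ⊆ D` then for a.e.
`t ∈ I`, `∫_B |u(t)|² ≤ E₀`. [folklore] -/
theorem ae_setLIntegral_slice_le_of_energy {D : Set (ℝ × ℝ³)} {u : ℝ → ℝ³ → ℝ³} {E₀ : ℝ≥0∞}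
    (h : ∀ᵐ t : ℝ, ∫⁻ x, D.indicator (fun z : ℝ × ℝ³ => ‖u z.1 z.2‖ₑ ^ 2) (t, x) ≤ E₀)
    {I : Set ℝ} {B : Set ℝ³} (hB : MeasurableSet B) (hsub : I ×ˢ B ⊆ D) :
    ∀ᵐ t : ℝ, t ∈ I → ∫⁻ x in B, ‖u t x‖ₑ ^ 2 ≤ E₀ := by
  filter_upwards [h] with t ht htI
  refine le_trans ?_ ht
  rw [← lintegral_indicator hB]
  refine lintegral_mono fun x => ?_
  by_cases hx : x ∈ B
  · rw [indicator_of_mem hx, indicator_of_mem (hsub (mk_mem_prod htI hx))]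
  · rw [indicator_of_notMem hx]
    exact zero_le

/-- `A_ess(r) ≤ r⁻¹ E₀` (the accepted `cknAEss` of `LocalTypeI.lean`: essential supremum over the
time slices of the backward cylinder) for cylinders inside the domain of CKN's energy bound. [folklore] -/
theorem cknAEss_le_of_energy {D : Set (ℝ × ℝ³)} {u : ℝ → ℝ³ → ℝ³} {E₀ : ℝ≥0∞}
    (h : ∀ᵐ t : ℝ, ∫⁻ x, D.indicator (fun z : ℝ × ℝ³ => ‖u z.1 z.2‖ₑ ^ 2) (t, x) ≤ E₀)
    {r : ℝ} {z : ℝ × ℝ³} (hsub : parabolicCylinder r z ⊆ D) :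
    cknAEss r z u ≤ (ENNReal.ofReal r)⁻¹ * E₀ := by
  refine essSup_le_of_ae_le _ ?_
  rw [Filter.EventuallyLE, ae_restrict_iff' measurableSet_Ioo]
  filter_upwards [ae_setLIntegral_slice_le_of_energy h measurableSet_ball hsub] with t ht htI
  exact mul_le_mul_right (ht htI) _

end Literature.Analysis.FluidPDE
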